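import Literature.AlgebraicGeometry.Hu2025.Statements.S01S09Interface.R110hSetupPrintedOurs
import Mathlib

/-!
# API of the split torus `splitTorusOver` and of the trivialisation field `quot_trivialises` (row 110 files g/h) —
# kernel tools for building inhabitants of `Hu22Setup_printed(_ours)` (J1 = HU-R01 reading (β): «kernel instance if an
# inhabitant at d_quad with X integral lands», res-adj-8 verdict file §WHAT WOULD MOVE THE WORDS). OURS; nothing of the
# sources asserted.

**HONEST FRAMING (D-0012/D-0089).** [Hu2025]/[Hu2022] are unrefereed preprints under adjudication; rows 101–110 type their
statements as candidates. Files g (`R110gSetupPrinted`, p523177) and h (`R110hSetupPrintedOurs`, p525500) record «the quotient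
map `π`» through the field `quot_trivialises` = a finite open cover of `U` over which `quot` is isomorphic OVER the base to
`O × 𝔾^{n−1}_m → O`, where `O × 𝔾^k_m := splitTorusOver k O` is the basic open `D(∏ sᵢ)` of Mathlib's `𝔸(Fin k; O)`. This file
is the interface owner's API for those definitions (res-type-024), so that an inhabitant can be assembled from RING data:
* `SplitTorusOver.mapIso` / `mapIso_hom_proj` — functoriality of `splitTorusOver k` along isomorphisms of the base;
* `SplitTorusOver.specIso k R : splitTorusOver k (Spec R) ≅ Spec R[s_1,…,s_k][1/∏ sᵢ]` over `Spec R` (`specIso_hom_over`);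
* `SplitTorusOver.Trivialises k q` = the shape of `quot_trivialises` / `Hu22P132L30` as a predicate on `q : Y ⟶ U`
  (`Hu22Setup.hu22P132L30_iff_trivialises : Hu22P132L30 S ↔ Trivialises (n-1) S.quot`, by `Iff.rfl`);
* `SplitTorusOver.trivialises_of_iso` — GLOBAL trivialisation (`Y ≅ splitTorusOver k U` over `U`) ⇒ `Trivialises k q` (cover `{⊤}`);
* `SplitTorusOver.trivialises_of_comp_iso` — transport along an isomorphism of the base `U ≅ U'`;
* `SplitTorusOver.trivialises_of_affine` — AFFINE CRITERION: `φ : B ⟶ C` with `C ≅ B[s][1/∏ sᵢ]` under `B` ⇒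
  `Trivialises k (Spec.map φ)`;
* `SplitTorusOver.basicOpenSpecIso f : D(f) ⊂ 𝔸(Fin r; Spec R) ≅ Spec R[t][1/f]` over `Spec R` (to present an open
  `U ⊂ X × 𝔸^r` with `X = Spec R` as an affine scheme: `polySection f` is the global section of `f ∈ R[t_1,…,t_r]`);
* packaging `Hu22Setup_ours.toPrintedOurs` / `Hu22Setup_ours.toPrinted`.
So: with `X := Spec R`, `U := D(f) ⊂ 𝔸(Fin r; Spec R)` (≅ `Spec R[t][1/f]` =: `Spec B`), `cell := Spec C` and `quot` = `Spec` of a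
ring map up to these isomorphisms, the field `quot_trivialises` follows from a `B`-algebra isomorphism `C ≅ B[s_1,…,s_{n−1}][1/∏ sᵢ]`
(`trivialises_of_affine` + `trivialises_of_comp_iso`). No statement about [Hu22]/[Hu25] is made or implied; universe `0` as in
rows 101–110. AI proof is weaker than expert review.
-/

noncomputable section

open CategoryTheory AlgebraicGeometry

namespace Literature.AlgebraicGeometry.Hu2025.Statements.S01S09Interface

open S08MainTheorem S07GammaSchemes S03Pluecker

namespace SplitTorusOver

/-! ### functoriality along isomorphisms of the base -/

/-- `AffineSpace.map` of an isomorphism of bases is an isomorphism (inverse `AffineSpace.map` of the inverse). OURS tool.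
[cite: Hu2022, p.132 l.30–51 ((9.4) `Gr_d|_O ≅ O × (𝔾ⁿ_m/𝔾_m)`, split `𝔾^{n−1}_m`) with p.134 l.38–40; joint J1 = GAP-LEDGER-HU row HU-R01 (unrefereed preprints arXiv:2203.03842v4 / arXiv:2507.21400v1 under adjudication, D-0012/D-0089 — API of OUR row-110 records g/h `splitTorusOver` / `quot_trivialises`; nothing of the sources asserted)] -/
instance isIso_affineSpace_map {S T : Scheme.{0}} (f : S ≅ T) (k : ℕ) :
    IsIso (AffineSpace.map (Fin k) f.hom) :=
  ⟨⟨AffineSpace.map (Fin k) f.inv, by rw [← AffineSpace.map_comp, f.hom_inv_id, AffineSpace.map_id],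
    by rw [← AffineSpace.map_comp, f.inv_hom_id, AffineSpace.map_id]⟩⟩

/-- The preimage of `splitTorusOver k T` under `AffineSpace.map (Fin k) f` is `splitTorusOver k S` (the coordinates pull back
to the coordinates). OURS tool. [cite: Hu2022, p.132 l.30–51 ((9.4) `Gr_d|_O ≅ O × (𝔾ⁿ_m/𝔾_m)`, split `𝔾^{n−1}_m`) with p.134 l.38–40; joint J1 = GAP-LEDGER-HU row HU-R01 (unrefereed preprints arXiv:2203.03842v4 / arXiv:2507.21400v1 under adjudication, D-0012/D-0089 — API of OUR row-110 records g/h `splitTorusOver` / `quot_trivialises`; nothing of the sources asserted)] -/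
theorem preimage_map {S T : Scheme.{0}} (f : S ⟶ T) (k : ℕ) :
    AffineSpace.map (Fin k) f ⁻¹ᵁ splitTorusOver k T = splitTorusOver k S := by
  simp only [splitTorusOver, Scheme.preimage_basicOpen_top, map_prod, AffineSpace.map_appTop_coord]

/-- **Functoriality**: the split torus over `S` is isomorphic to the split torus over `T` along an isomorphism `S ≅ T`.
OURS tool. [cite: Hu2022, p.132 l.30–51 ((9.4) `Gr_d|_O ≅ O × (𝔾ⁿ_m/𝔾_m)`, split `𝔾^{n−1}_m`) with p.134 l.38–40; joint J1 = GAP-LEDGER-HU row HU-R01 (unrefereed preprints arXiv:2203.03842v4 / arXiv:2507.21400v1 under adjudication, D-0012/D-0089 — API of OUR row-110 records g/h `splitTorusOver` / `quot_trivialises`; nothing of the sources asserted)] -/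
def mapIso {S T : Scheme.{0}} (f : S ≅ T) (k : ℕ) :
    (splitTorusOver k S : Scheme.{0}) ≅ (splitTorusOver k T : Scheme.{0}) :=
  (𝔸(Fin k; S)).isoOfEq (preimage_map f.hom k).symm ≪≫ asIso (AffineSpace.map (Fin k) f.hom ∣_ splitTorusOver k T)

/-- `mapIso` commutes with the projections: `mapIso.hom ≫ proj_T = proj_S ≫ f.hom`. OURS tool. [cite: Hu2022, p.132 l.30–51 ((9.4) `Gr_d|_O ≅ O × (𝔾ⁿ_m/𝔾_m)`, split `𝔾^{n−1}_m`) with p.134 l.38–40; joint J1 = GAP-LEDGER-HU row HU-R01 (unrefereed preprints arXiv:2203.03842v4 / arXiv:2507.21400v1 under adjudication, D-0012/D-0089 — API of OUR row-110 records g/h `splitTorusOver` / `quot_trivialises`; nothing of the sources asserted)] -/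
@[reassoc]
theorem mapIso_hom_proj {S T : Scheme.{0}} (f : S ≅ T) (k : ℕ) :
    (mapIso f k).hom ≫ splitTorusOverProj k T = splitTorusOverProj k S ≫ f.hom := by
  simp only [mapIso, Iso.trans_hom, asIso_hom, splitTorusOverProj, Category.assoc]
  rw [morphismRestrict_ι_assoc, AffineSpace.map_over, Scheme.isoOfEq_hom_ι_assoc]

/-! ### the global-trivialisation constructor (cover `{⊤}`) -/

/-- **Global-trivialisation constructor**: if `q : Y ⟶ U` is isomorphic OVER `U` to the projection
`splitTorusOver k U ⟶ U`, then `q` has the shape of `quot_trivialises` / `Hu22P132L30` with the one-open cover `{⊤}`.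
OURS tool. [cite: Hu2022, p.132 l.30–51 ((9.4) `Gr_d|_O ≅ O × (𝔾ⁿ_m/𝔾_m)`, split `𝔾^{n−1}_m`) with p.134 l.38–40; joint J1 = GAP-LEDGER-HU row HU-R01 (unrefereed preprints arXiv:2203.03842v4 / arXiv:2507.21400v1 under adjudication, D-0012/D-0089 — API of OUR row-110 records g/h `splitTorusOver` / `quot_trivialises`; nothing of the sources asserted)] -/
theorem exists_trivialisation_of_iso {Y U : Scheme.{0}} (q : Y ⟶ U) (k : ℕ)
    (e : Y ≅ (splitTorusOver k U : Scheme.{0})) (he : e.hom ≫ splitTorusOverProj k U = q) :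
    ∃ (ι : Type) (_ : Finite ι) (O : ι → U.Opens), (⨆ j, O j) = ⊤ ∧
      ∀ j, ∃ e' : ((q ⁻¹ᵁ (O j) : Y.Opens) : Scheme.{0}) ≅ (splitTorusOver k (O j : Scheme.{0}) : Scheme.{0}),
        e'.hom ≫ splitTorusOverProj k (O j : Scheme.{0}) = q ∣_ (O j) := by
  refine ⟨Unit, inferInstance, fun _ => ⊤, by simp, fun _ => ?_⟩
  -- the iso: q⁻¹ ⊤ = ⊤ ≅ Y ≅ torus over U ≅ torus over ↑⊤
  let e₁ : ((q ⁻¹ᵁ (⊤ : U.Opens) : Y.Opens) : Scheme.{0}) ≅ Y := Y.topIso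
  let e' := e₁ ≪≫ e ≪≫ mapIso U.topIso.symm k
  refine ⟨e', ?_⟩
  have h1 : e'.hom ≫ splitTorusOverProj k ((⊤ : U.Opens) : Scheme.{0}) = e₁.hom ≫ q ≫ U.topIso.inv := by
    simp only [e', Iso.trans_hom, Category.assoc, mapIso_hom_proj, Iso.symm_hom, ← he]
  rw [h1, ← cancel_mono (⊤ : U.Opens).ι]
  simp only [Category.assoc, morphismRestrict_ι]
  rw [show (⊤ : U.Opens).ι = U.topIso.hom from rfl, Iso.inv_hom_id, Category.comp_id]
  rfl

/-! ### affine description over `Spec R` -/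

/-- `∏ᵢ sᵢ ∈ R[s_1, …, s_k]` (the element inverted on the split torus; [Hu22] p.132 l.46–51 `Spec 𝔽[s^±_1, …, s^±_{n−1}]`).
OURS tool. [cite: Hu2022, p.132 l.30–51 ((9.4) `Gr_d|_O ≅ O × (𝔾ⁿ_m/𝔾_m)`, split `𝔾^{n−1}_m`) with p.134 l.38–40; joint J1 = GAP-LEDGER-HU row HU-R01 (unrefereed preprints arXiv:2203.03842v4 / arXiv:2507.21400v1 under adjudication, D-0012/D-0089 — API of OUR row-110 records g/h `splitTorusOver` / `quot_trivialises`; nothing of the sources asserted)] -/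
abbrev coordProd (k : ℕ) (R : Type) [CommRing R] : MvPolynomial (Fin k) R := ∏ i : Fin k, MvPolynomial.X i

/-- The open immersion `splitTorusOver k (Spec R) ⟶ Spec R[s]` (inclusion followed by Mathlib's `AffineSpace.SpecIso`).
OURS tool. [cite: Hu2022, p.132 l.30–51 ((9.4) `Gr_d|_O ≅ O × (𝔾ⁿ_m/𝔾_m)`, split `𝔾^{n−1}_m`) with p.134 l.38–40; joint J1 = GAP-LEDGER-HU row HU-R01 (unrefereed preprints arXiv:2203.03842v4 / arXiv:2507.21400v1 under adjudication, D-0012/D-0089 — API of OUR row-110 records g/h `splitTorusOver` / `quot_trivialises`; nothing of the sources asserted)] -/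
def toSpecPoly (k : ℕ) (R : CommRingCat.{0}) :
    (splitTorusOver k (Spec R) : Scheme.{0}) ⟶ Spec (CommRingCat.of (MvPolynomial (Fin k) R)) :=
  (splitTorusOver k (Spec R)).ι ≫ (AffineSpace.SpecIso (Fin k) R).hom

/-- `toSpecPoly` is an open immersion. OURS tool. [cite: Hu2022, p.132 l.30–51 ((9.4) `Gr_d|_O ≅ O × (𝔾ⁿ_m/𝔾_m)`, split `𝔾^{n−1}_m`) with p.134 l.38–40; joint J1 = GAP-LEDGER-HU row HU-R01 (unrefereed preprints arXiv:2203.03842v4 / arXiv:2507.21400v1 under adjudication, D-0012/D-0089 — API of OUR row-110 records g/h `splitTorusOver` / `quot_trivialises`; nothing of the sources asserted)] -/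
instance (k : ℕ) (R : CommRingCat.{0}) : IsOpenImmersion (toSpecPoly k R) := by
  unfold toSpecPoly; infer_instance

/-- Under `AffineSpace.SpecIso`, the split torus is the basic open `D(∏ sᵢ)` of `Spec R[s]`. OURS tool. [cite: Hu2022, p.132 l.30–51 ((9.4) `Gr_d|_O ≅ O × (𝔾ⁿ_m/𝔾_m)`, split `𝔾^{n−1}_m`) with p.134 l.38–40; joint J1 = GAP-LEDGER-HU row HU-R01 (unrefereed preprints arXiv:2203.03842v4 / arXiv:2507.21400v1 under adjudication, D-0012/D-0089 — API of OUR row-110 records g/h `splitTorusOver` / `quot_trivialises`; nothing of the sources asserted)] -/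
theorem preimage_SpecIso_inv (k : ℕ) (R : CommRingCat.{0}) :
    (AffineSpace.SpecIso (Fin k) R).inv ⁻¹ᵁ splitTorusOver k (Spec R) =
      (Spec (CommRingCat.of (MvPolynomial (Fin k) R))).basicOpen
        ((Scheme.ΓSpecIso (CommRingCat.of (MvPolynomial (Fin k) R))).inv (coordProd k R)) := by
  simp only [splitTorusOver, Scheme.preimage_basicOpen_top, map_prod, AffineSpace.SpecIso_inv_appTop_coord,
    coordProd]

/-- The image of `toSpecPoly` is the basic open `D(∏ sᵢ)` of `Spec R[s]` (as a set of primes). OURS tool. [cite: Hu2022, p.132 l.30–51 ((9.4) `Gr_d|_O ≅ O × (𝔾ⁿ_m/𝔾_m)`, split `𝔾^{n−1}_m`) with p.134 l.38–40; joint J1 = GAP-LEDGER-HU row HU-R01 (unrefereed preprints arXiv:2203.03842v4 / arXiv:2507.21400v1 under adjudication, D-0012/D-0089 — API of OUR row-110 records g/h `splitTorusOver` / `quot_trivialises`; nothing of the sources asserted)] -/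
theorem range_toSpecPoly (k : ℕ) (R : CommRingCat.{0}) :
    Set.range (toSpecPoly k R).base =
      ((PrimeSpectrum.basicOpen (coordProd k R) : TopologicalSpace.Opens (PrimeSpectrum (MvPolynomial (Fin k) R))) :
        Set (PrimeSpectrum (MvPolynomial (Fin k) R))) := by
  have h1 : Set.range (toSpecPoly k R).base =
      (AffineSpace.SpecIso (Fin k) R).hom.base '' ((splitTorusOver k (Spec R) : (𝔸(Fin k; Spec R)).Opens) : Set _) := by
    rw [toSpecPoly, Scheme.Hom.comp_base, TopCat.coe_comp, Set.range_comp, Scheme.Opens.range_ι]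
  have h2 : (AffineSpace.SpecIso (Fin k) R).hom.base '' ((splitTorusOver k (Spec R) : (𝔸(Fin k; Spec R)).Opens) : Set _)
      = (AffineSpace.SpecIso (Fin k) R).inv.base ⁻¹' ((splitTorusOver k (Spec R) : (𝔸(Fin k; Spec R)).Opens) : Set _) := by
    rw [Set.image_eq_preimage_of_inverse]
    · intro x; exact Scheme.hom_inv_apply _ x
    · intro y; exact Scheme.inv_hom_apply _ y
  rw [h1, h2]
  change SetLike.coe ((AffineSpace.SpecIso (Fin k) R).inv ⁻¹ᵁ splitTorusOver k (Spec R)) = _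
  rw [preimage_SpecIso_inv, basicOpen_eq_of_affine]
  rfl

/-- **The split torus over an affine base is affine**: `splitTorusOver k (Spec R) ≅ Spec R[s_1,…,s_k][1/∏ sᵢ]` (two open
immersions into `Spec R[s]` with the same image). OURS tool. [cite: Hu2022, p.132 l.30–51 ((9.4) `Gr_d|_O ≅ O × (𝔾ⁿ_m/𝔾_m)`, split `𝔾^{n−1}_m`) with p.134 l.38–40; joint J1 = GAP-LEDGER-HU row HU-R01 (unrefereed preprints arXiv:2203.03842v4 / arXiv:2507.21400v1 under adjudication, D-0012/D-0089 — API of OUR row-110 records g/h `splitTorusOver` / `quot_trivialises`; nothing of the sources asserted)] -/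
def specIso (k : ℕ) (R : CommRingCat.{0}) :
    (splitTorusOver k (Spec R) : Scheme.{0}) ≅
      Spec (CommRingCat.of (Localization.Away (coordProd k R))) :=
  haveI : IsOpenImmersion (Spec.map (CommRingCat.ofHom
      (algebraMap (MvPolynomial (Fin k) R) (Localization.Away (coordProd k R))))) :=
    IsOpenImmersion.of_isLocalization (coordProd k R)
  IsOpenImmersion.isoOfRangeEq (toSpecPoly k R)
    (Spec.map (CommRingCat.ofHom (algebraMap (MvPolynomial (Fin k) R) (Localization.Away (coordProd k R)))))
    (by
      have hr : Set.range (Spec.map (CommRingCat.ofHom (algebraMap (MvPolynomial (Fin k) R)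
          (Localization.Away (coordProd k R))))).base =
          Set.range (PrimeSpectrum.comap (algebraMap (MvPolynomial (Fin k) R) (Localization.Away (coordProd k R)))) := by
        rw [Spec.map_base]; rfl
      rw [range_toSpecPoly, hr, PrimeSpectrum.localization_away_comap_range (Localization.Away (coordProd k R))
        (coordProd k R)])

/-- `specIso` over `Spec R[s]`. OURS tool. [cite: Hu2022, p.132 l.30–51 ((9.4) `Gr_d|_O ≅ O × (𝔾ⁿ_m/𝔾_m)`, split `𝔾^{n−1}_m`) with p.134 l.38–40; joint J1 = GAP-LEDGER-HU row HU-R01 (unrefereed preprints arXiv:2203.03842v4 / arXiv:2507.21400v1 under adjudication, D-0012/D-0089 — API of OUR row-110 records g/h `splitTorusOver` / `quot_trivialises`; nothing of the sources asserted)] -/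
@[reassoc]
theorem specIso_hom_fac (k : ℕ) (R : CommRingCat.{0}) :
    (specIso k R).hom ≫ Spec.map (CommRingCat.ofHom
      (algebraMap (MvPolynomial (Fin k) R) (Localization.Away (coordProd k R)))) = toSpecPoly k R := by
  haveI : IsOpenImmersion (Spec.map (CommRingCat.ofHom
      (algebraMap (MvPolynomial (Fin k) R) (Localization.Away (coordProd k R))))) :=
    IsOpenImmersion.of_isLocalization (coordProd k R)
  exact IsOpenImmersion.isoOfRangeEq_hom_fac _ _ _

/-- `specIso` commutes with the projections to `Spec R` (`splitTorusOverProj` vs `Spec` of `R → R[s][1/∏ sᵢ]`). OURS tool.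
[cite: Hu2022, p.132 l.30–51 ((9.4) `Gr_d|_O ≅ O × (𝔾ⁿ_m/𝔾_m)`, split `𝔾^{n−1}_m`) with p.134 l.38–40; joint J1 = GAP-LEDGER-HU row HU-R01 (unrefereed preprints arXiv:2203.03842v4 / arXiv:2507.21400v1 under adjudication, D-0012/D-0089 — API of OUR row-110 records g/h `splitTorusOver` / `quot_trivialises`; nothing of the sources asserted)] -/
@[reassoc]
theorem specIso_hom_over (k : ℕ) (R : CommRingCat.{0}) :
    (specIso k R).hom ≫ Spec.map (CommRingCat.ofHom (algebraMap R (Localization.Away (coordProd k R)))) =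
      splitTorusOverProj k (Spec R) := by
  rw [IsScalarTower.algebraMap_eq R (MvPolynomial (Fin k) R) (Localization.Away (coordProd k R)),
    CommRingCat.ofHom_comp, Spec.map_comp, specIso_hom_fac_assoc, toSpecPoly, splitTorusOverProj, Category.assoc]
  congr 1
  rw [← Iso.eq_inv_comp, AffineSpace.SpecIso_inv_over, MvPolynomial.algebraMap_eq]

/-! ### transport of the trivialisation statement along an isomorphism of the base -/

/-- **The shape of `Hu22Setup_printed(_ours).quot_trivialises` / `Hu22P132L30`** as a predicate on a morphism `q : Y ⟶ U`:
a finite open cover `{O_j}` of `U` and isomorphisms `q⁻¹(O_j) ≅ O_j × 𝔾^k_m` OVER `O_j` ([Hu22] p.132 (9.4), READING of g/h).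
OURS tool. [cite: Hu2022, p.132 l.30–51 ((9.4) `Gr_d|_O ≅ O × (𝔾ⁿ_m/𝔾_m)`, split `𝔾^{n−1}_m`) with p.134 l.38–40; joint J1 = GAP-LEDGER-HU row HU-R01 (unrefereed preprints arXiv:2203.03842v4 / arXiv:2507.21400v1 under adjudication, D-0012/D-0089 — API of OUR row-110 records g/h `splitTorusOver` / `quot_trivialises`; nothing of the sources asserted)] -/
def Trivialises (k : ℕ) {Y U : Scheme.{0}} (q : Y ⟶ U) : Prop :=
  ∃ (ι : Type) (_ : Finite ι) (O : ι → U.Opens), (⨆ j, O j) = ⊤ ∧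
    ∀ j, ∃ e' : ((q ⁻¹ᵁ (O j) : Y.Opens) : Scheme.{0}) ≅ (splitTorusOver k (O j : Scheme.{0}) : Scheme.{0}),
      e'.hom ≫ splitTorusOverProj k (O j : Scheme.{0}) = q ∣_ (O j)

/-- Global trivialisation ⇒ `Trivialises` (= `exists_trivialisation_of_iso`). OURS tool. [cite: Hu2022, p.132 l.30–51 ((9.4) `Gr_d|_O ≅ O × (𝔾ⁿ_m/𝔾_m)`, split `𝔾^{n−1}_m`) with p.134 l.38–40; joint J1 = GAP-LEDGER-HU row HU-R01 (unrefereed preprints arXiv:2203.03842v4 / arXiv:2507.21400v1 under adjudication, D-0012/D-0089 — API of OUR row-110 records g/h `splitTorusOver` / `quot_trivialises`; nothing of the sources asserted)] -/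
theorem trivialises_of_iso {Y U : Scheme.{0}} (q : Y ⟶ U) (k : ℕ)
    (e : Y ≅ (splitTorusOver k U : Scheme.{0})) (he : e.hom ≫ splitTorusOverProj k U = q) :
    Trivialises k q :=
  exists_trivialisation_of_iso q k e he

/-- **Transport along an isomorphism of the base**: if `q ≫ f.hom` trivialises over `U'` for an isomorphism `f : U ≅ U'`,
then `q` trivialises over `U` (pull the cover back along `f`, restrict `f` to each open). OURS tool. [cite: Hu2022, p.132 l.30–51 ((9.4) `Gr_d|_O ≅ O × (𝔾ⁿ_m/𝔾_m)`, split `𝔾^{n−1}_m`) with p.134 l.38–40; joint J1 = GAP-LEDGER-HU row HU-R01 (unrefereed preprints arXiv:2203.03842v4 / arXiv:2507.21400v1 under adjudication, D-0012/D-0089 — API of OUR row-110 records g/h `splitTorusOver` / `quot_trivialises`; nothing of the sources asserted)] -/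
theorem trivialises_of_comp_iso {Y U U' : Scheme.{0}} (q : Y ⟶ U) (f : U ≅ U') (k : ℕ)
    (h : Trivialises k (q ≫ f.hom)) : Trivialises k q := by
  obtain ⟨ι, hι, O', hO', h⟩ := h
  refine ⟨ι, hι, fun j => f.hom ⁻¹ᵁ O' j, ?_, fun j => ?_⟩
  · -- the pulled-back cover is a cover
    apply le_antisymm le_top
    intro x _
    have hx : f.hom.base x ∈ (⨆ j, O' j) := by rw [hO']; trivial
    obtain ⟨j, hj⟩ := TopologicalSpace.Opens.mem_iSup.mp hx
    exact TopologicalSpace.Opens.mem_iSup.mpr ⟨j, hj⟩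
  · obtain ⟨e', he'⟩ := h j
    -- `↑(f ⁻¹ O'_j) ≅ ↑O'_j` by restricting the iso `f`
    let fj : ((f.hom ⁻¹ᵁ O' j : U.Opens) : Scheme.{0}) ≅ (O' j : Scheme.{0}) := asIso (f.hom ∣_ O' j)
    refine ⟨e' ≪≫ mapIso fj.symm k, ?_⟩
    show (e' ≪≫ mapIso fj.symm k).hom ≫ splitTorusOverProj k ((f.hom ⁻¹ᵁ O' j : U.Opens) : Scheme.{0}) =
      q ∣_ (f.hom ⁻¹ᵁ O' j)
    have goal' : (e' ≪≫ mapIso fj.symm k).hom ≫ splitTorusOverProj k ((f.hom ⁻¹ᵁ O' j : U.Opens) : Scheme.{0}) ≫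
        fj.hom = (q ≫ f.hom) ∣_ O' j := by
      rw [Iso.trans_hom, Category.assoc, mapIso_hom_proj_assoc, Iso.symm_hom, Iso.inv_hom_id, Category.comp_id]
      exact he'
    rw [← cancel_mono fj.hom, Category.assoc, goal']
    exact morphismRestrict_comp q f.hom (O' j)

/-! ### the affine criterion -/

/-- **Affine criterion.** If `φ : B ⟶ C` becomes the structure map after an isomorphism of `C` with `B[s_1,…,s_k][1/∏ sᵢ]`
under `B` (`φ ≫ ψ.hom = algebraMap`), then `Spec φ : Spec C ⟶ Spec B` trivialises (globally) with fibre the split torus of rank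
`k` — the ring-level form in which a torus-quotient inhabitant can be supplied. OURS tool. [cite: Hu2022, p.132 l.30–51 ((9.4) `Gr_d|_O ≅ O × (𝔾ⁿ_m/𝔾_m)`, split `𝔾^{n−1}_m`) with p.134 l.38–40; joint J1 = GAP-LEDGER-HU row HU-R01 (unrefereed preprints arXiv:2203.03842v4 / arXiv:2507.21400v1 under adjudication, D-0012/D-0089 — API of OUR row-110 records g/h `splitTorusOver` / `quot_trivialises`; nothing of the sources asserted)] -/
theorem trivialises_of_affine (k : ℕ) {B C : CommRingCat.{0}} (φ : B ⟶ C)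
    (ψ : C ≅ CommRingCat.of (Localization.Away (coordProd k B)))
    (hψ : φ ≫ ψ.hom = CommRingCat.ofHom (algebraMap B (Localization.Away (coordProd k B)))) :
    Trivialises k (Spec.map φ) := by
  refine trivialises_of_iso (Spec.map φ) k (asIso (Spec.map ψ.inv) ≪≫ (specIso k B).symm) ?_
  have h1 : (specIso k B).inv ≫ splitTorusOverProj k (Spec B) =
      Spec.map (CommRingCat.ofHom (algebraMap B (Localization.Away (coordProd k B)))) := by
    rw [Iso.inv_comp_eq, specIso_hom_over]
  have h2 : φ = CommRingCat.ofHom (algebraMap B (Localization.Away (coordProd k B))) ≫ ψ.inv := by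
    rw [← hψ, Category.assoc, Iso.hom_inv_id, Category.comp_id]
  rw [Iso.trans_hom, asIso_hom, Iso.symm_hom, Category.assoc, h1, ← Spec.map_comp, ← h2]

/-! ### basic opens of affine space over an affine base are affine (for building `U ⊂ X × 𝔸^r`) -/

/-- The global section of `𝔸(Fin r; Spec R)` corresponding to a polynomial `f ∈ R[t_1,…,t_r]` (through `AffineSpace.SpecIso`).
OURS tool. [cite: Hu2022, p.132 l.30–51 ((9.4) `Gr_d|_O ≅ O × (𝔾ⁿ_m/𝔾_m)`, split `𝔾^{n−1}_m`) with p.134 l.38–40; joint J1 = GAP-LEDGER-HU row HU-R01 (unrefereed preprints arXiv:2203.03842v4 / arXiv:2507.21400v1 under adjudication, D-0012/D-0089 — API of OUR row-110 records g/h `splitTorusOver` / `quot_trivialises`; nothing of the sources asserted)] -/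
def polySection {r : ℕ} {R : CommRingCat.{0}} (f : MvPolynomial (Fin r) R) : Γ(𝔸(Fin r; Spec R), ⊤) :=
  (AffineSpace.SpecIso (Fin r) R).hom.appTop ((Scheme.ΓSpecIso (CommRingCat.of (MvPolynomial (Fin r) R))).inv f)

/-- `polySection f` pulls back to `f` along `AffineSpace.SpecIso`. OURS tool. [cite: Hu2022, p.132 l.30–51 ((9.4) `Gr_d|_O ≅ O × (𝔾ⁿ_m/𝔾_m)`, split `𝔾^{n−1}_m`) with p.134 l.38–40; joint J1 = GAP-LEDGER-HU row HU-R01 (unrefereed preprints arXiv:2203.03842v4 / arXiv:2507.21400v1 under adjudication, D-0012/D-0089 — API of OUR row-110 records g/h `splitTorusOver` / `quot_trivialises`; nothing of the sources asserted)] -/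
theorem SpecIso_inv_appTop_polySection {r : ℕ} {R : CommRingCat.{0}} (f : MvPolynomial (Fin r) R) :
    (AffineSpace.SpecIso (Fin r) R).inv.appTop (polySection f) =
      (Scheme.ΓSpecIso (CommRingCat.of (MvPolynomial (Fin r) R))).inv f := by
  rw [polySection, ← CommRingCat.comp_apply, ← Scheme.Hom.comp_appTop, Iso.inv_hom_id]
  simp

/-- Under `AffineSpace.SpecIso`, `D(polySection f)` is the basic open `D(f)` of `Spec R[t]`. OURS tool. [cite: Hu2022, p.132 l.30–51 ((9.4) `Gr_d|_O ≅ O × (𝔾ⁿ_m/𝔾_m)`, split `𝔾^{n−1}_m`) with p.134 l.38–40; joint J1 = GAP-LEDGER-HU row HU-R01 (unrefereed preprints arXiv:2203.03842v4 / arXiv:2507.21400v1 under adjudication, D-0012/D-0089 — API of OUR row-110 records g/h `splitTorusOver` / `quot_trivialises`; nothing of the sources asserted)] -/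
theorem preimage_SpecIso_inv_basicOpen {r : ℕ} {R : CommRingCat.{0}} (f : MvPolynomial (Fin r) R) :
    (AffineSpace.SpecIso (Fin r) R).inv ⁻¹ᵁ (𝔸(Fin r; Spec R)).basicOpen (polySection f) =
      (Spec (CommRingCat.of (MvPolynomial (Fin r) R))).basicOpen
        ((Scheme.ΓSpecIso (CommRingCat.of (MvPolynomial (Fin r) R))).inv f) := by
  rw [Scheme.preimage_basicOpen_top, SpecIso_inv_appTop_polySection]

/-- The open immersion `D(f) ⊂ 𝔸(Fin r; Spec R) ⟶ Spec R[t]`. OURS tool. [cite: Hu2022, p.132 l.30–51 ((9.4) `Gr_d|_O ≅ O × (𝔾ⁿ_m/𝔾_m)`, split `𝔾^{n−1}_m`) with p.134 l.38–40; joint J1 = GAP-LEDGER-HU row HU-R01 (unrefereed preprints arXiv:2203.03842v4 / arXiv:2507.21400v1 under adjudication, D-0012/D-0089 — API of OUR row-110 records g/h `splitTorusOver` / `quot_trivialises`; nothing of the sources asserted)] -/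
def basicOpenToSpecPoly {r : ℕ} {R : CommRingCat.{0}} (f : MvPolynomial (Fin r) R) :
    (((𝔸(Fin r; Spec R)).basicOpen (polySection f) : (𝔸(Fin r; Spec R)).Opens) : Scheme.{0}) ⟶
      Spec (CommRingCat.of (MvPolynomial (Fin r) R)) :=
  ((𝔸(Fin r; Spec R)).basicOpen (polySection f)).ι ≫ (AffineSpace.SpecIso (Fin r) R).hom

/-- `basicOpenToSpecPoly f` is an open immersion. OURS tool. [cite: Hu2022, p.132 l.30–51 ((9.4) `Gr_d|_O ≅ O × (𝔾ⁿ_m/𝔾_m)`, split `𝔾^{n−1}_m`) with p.134 l.38–40; joint J1 = GAP-LEDGER-HU row HU-R01 (unrefereed preprints arXiv:2203.03842v4 / arXiv:2507.21400v1 under adjudication, D-0012/D-0089 — API of OUR row-110 records g/h `splitTorusOver` / `quot_trivialises`; nothing of the sources asserted)] -/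
instance {r : ℕ} {R : CommRingCat.{0}} (f : MvPolynomial (Fin r) R) : IsOpenImmersion (basicOpenToSpecPoly f) := by
  unfold basicOpenToSpecPoly; infer_instance

/-- The image of `basicOpenToSpecPoly f` is `D(f)` (as a set of primes of `R[t]`). OURS tool. [cite: Hu2022, p.132 l.30–51 ((9.4) `Gr_d|_O ≅ O × (𝔾ⁿ_m/𝔾_m)`, split `𝔾^{n−1}_m`) with p.134 l.38–40; joint J1 = GAP-LEDGER-HU row HU-R01 (unrefereed preprints arXiv:2203.03842v4 / arXiv:2507.21400v1 under adjudication, D-0012/D-0089 — API of OUR row-110 records g/h `splitTorusOver` / `quot_trivialises`; nothing of the sources asserted)] -/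
theorem range_basicOpenToSpecPoly {r : ℕ} {R : CommRingCat.{0}} (f : MvPolynomial (Fin r) R) :
    Set.range (basicOpenToSpecPoly f).base =
      ((PrimeSpectrum.basicOpen f : TopologicalSpace.Opens (PrimeSpectrum (MvPolynomial (Fin r) R))) :
        Set (PrimeSpectrum (MvPolynomial (Fin r) R))) := by
  have h1 : Set.range (basicOpenToSpecPoly f).base = (AffineSpace.SpecIso (Fin r) R).hom.base ''
      (((𝔸(Fin r; Spec R)).basicOpen (polySection f) : (𝔸(Fin r; Spec R)).Opens) : Set _) := by
    rw [basicOpenToSpecPoly, Scheme.Hom.comp_base, TopCat.coe_comp, Set.range_comp, Scheme.Opens.range_ι]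
  have h2 : (AffineSpace.SpecIso (Fin r) R).hom.base ''
      (((𝔸(Fin r; Spec R)).basicOpen (polySection f) : (𝔸(Fin r; Spec R)).Opens) : Set _)
      = (AffineSpace.SpecIso (Fin r) R).inv.base ⁻¹'
      (((𝔸(Fin r; Spec R)).basicOpen (polySection f) : (𝔸(Fin r; Spec R)).Opens) : Set _) := by
    rw [Set.image_eq_preimage_of_inverse]
    · intro x; exact Scheme.hom_inv_apply _ x
    · intro y; exact Scheme.inv_hom_apply _ y
  rw [h1, h2]
  change SetLike.coe ((AffineSpace.SpecIso (Fin r) R).inv ⁻¹ᵁ (𝔸(Fin r; Spec R)).basicOpen (polySection f)) = _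
  rw [preimage_SpecIso_inv_basicOpen, basicOpen_eq_of_affine]
  rfl

/-- **A basic open of affine space over an affine base is affine**: `D(f) ⊂ 𝔸(Fin r; Spec R)` is `Spec R[t][1/f]` (use: to
present an open `U ⊂ X × 𝔸^r`, `X = Spec R`, of an inhabitant as `Spec B`). OURS tool. [cite: Hu2022, p.132 l.30–51 ((9.4) `Gr_d|_O ≅ O × (𝔾ⁿ_m/𝔾_m)`, split `𝔾^{n−1}_m`) with p.134 l.38–40; joint J1 = GAP-LEDGER-HU row HU-R01 (unrefereed preprints arXiv:2203.03842v4 / arXiv:2507.21400v1 under adjudication, D-0012/D-0089 — API of OUR row-110 records g/h `splitTorusOver` / `quot_trivialises`; nothing of the sources asserted)] -/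
def basicOpenSpecIso {r : ℕ} {R : CommRingCat.{0}} (f : MvPolynomial (Fin r) R) :
    (((𝔸(Fin r; Spec R)).basicOpen (polySection f) : (𝔸(Fin r; Spec R)).Opens) : Scheme.{0}) ≅
      Spec (CommRingCat.of (Localization.Away f)) :=
  haveI : IsOpenImmersion (Spec.map (CommRingCat.ofHom
      (algebraMap (MvPolynomial (Fin r) R) (Localization.Away f)))) :=
    IsOpenImmersion.of_isLocalization f
  IsOpenImmersion.isoOfRangeEq (basicOpenToSpecPoly f)
    (Spec.map (CommRingCat.ofHom (algebraMap (MvPolynomial (Fin r) R) (Localization.Away f))))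
    (by
      have hr : Set.range (Spec.map (CommRingCat.ofHom (algebraMap (MvPolynomial (Fin r) R)
          (Localization.Away f)))).base =
          Set.range (PrimeSpectrum.comap (algebraMap (MvPolynomial (Fin r) R) (Localization.Away f))) := by
        rw [Spec.map_base]; rfl
      rw [range_basicOpenToSpecPoly, hr, PrimeSpectrum.localization_away_comap_range (Localization.Away f) f])

/-- `basicOpenSpecIso` over `Spec R[t]`. OURS tool. [cite: Hu2022, p.132 l.30–51 ((9.4) `Gr_d|_O ≅ O × (𝔾ⁿ_m/𝔾_m)`, split `𝔾^{n−1}_m`) with p.134 l.38–40; joint J1 = GAP-LEDGER-HU row HU-R01 (unrefereed preprints arXiv:2203.03842v4 / arXiv:2507.21400v1 under adjudication, D-0012/D-0089 — API of OUR row-110 records g/h `splitTorusOver` / `quot_trivialises`; nothing of the sources asserted)] -/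
@[reassoc]
theorem basicOpenSpecIso_hom_fac {r : ℕ} {R : CommRingCat.{0}} (f : MvPolynomial (Fin r) R) :
    (basicOpenSpecIso f).hom ≫ Spec.map (CommRingCat.ofHom
      (algebraMap (MvPolynomial (Fin r) R) (Localization.Away f))) = basicOpenToSpecPoly f := by
  haveI : IsOpenImmersion (Spec.map (CommRingCat.ofHom
      (algebraMap (MvPolynomial (Fin r) R) (Localization.Away f)))) :=
    IsOpenImmersion.of_isLocalization f
  exact IsOpenImmersion.isoOfRangeEq_hom_fac _ _ _

/-- `basicOpenSpecIso` commutes with the projections to `Spec R`. OURS tool. [cite: Hu2022, p.132 l.30–51 ((9.4) `Gr_d|_O ≅ O × (𝔾ⁿ_m/𝔾_m)`, split `𝔾^{n−1}_m`) with p.134 l.38–40; joint J1 = GAP-LEDGER-HU row HU-R01 (unrefereed preprints arXiv:2203.03842v4 / arXiv:2507.21400v1 under adjudication, D-0012/D-0089 — API of OUR row-110 records g/h `splitTorusOver` / `quot_trivialises`; nothing of the sources asserted)] -/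
@[reassoc]
theorem basicOpenSpecIso_hom_over {r : ℕ} {R : CommRingCat.{0}} (f : MvPolynomial (Fin r) R) :
    (basicOpenSpecIso f).hom ≫ Spec.map (CommRingCat.ofHom (algebraMap R (Localization.Away f))) =
      ((𝔸(Fin r; Spec R)).basicOpen (polySection f)).ι ≫ (𝔸(Fin r; Spec R) ↘ Spec R) := by
  rw [IsScalarTower.algebraMap_eq R (MvPolynomial (Fin r) R) (Localization.Away f),
    CommRingCat.ofHom_comp, Spec.map_comp, basicOpenSpecIso_hom_fac_assoc, basicOpenToSpecPoly, Category.assoc]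
  congr 1
  rw [← Iso.eq_inv_comp, AffineSpace.SpecIso_inv_over, MvPolynomial.algebraMap_eq]

end SplitTorusOver

/-! ### bridges to the row-110 records -/

section Bridges

variable {𝔽 : Type} [Field 𝔽] {n : ℕ} {M : HuMatroid n 3}

/-- `Hu22P132L30 S` (g) is, by definition, `SplitTorusOver.Trivialises (n - 1) S.quot`; the fields `quot_trivialises` of g/h are
the same shape. OURS bookkeeping. [cite: Hu2022, p.132 l.30–51 ((9.4) `Gr_d|_O ≅ O × (𝔾ⁿ_m/𝔾_m)`, split `𝔾^{n−1}_m`) with p.134 l.38–40; joint J1 = GAP-LEDGER-HU row HU-R01 (unrefereed preprints arXiv:2203.03842v4 / arXiv:2507.21400v1 under adjudication, D-0012/D-0089 — API of OUR row-110 records g/h `splitTorusOver` / `quot_trivialises`; nothing of the sources asserted)] -/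
theorem Hu22Setup.hu22P132L30_iff_trivialises (S : Hu22Setup 𝔽 n M) :
    Hu22P132L30 S ↔ SplitTorusOver.Trivialises (n - 1) S.quot := Iff.rfl

/-- **Packaging (file h)**: an `Hu22Setup_ours` datum with `0 < r`, torus freeness (R110c `TorusFreeOnCell`), an isomorphism
`U ≅ L.barGr n d hfree` and `Trivialises (n-1) quot` is an `Hu22Setup_printed_ours L 𝔽 n d` datum. OURS bookkeeping; EXISTENCE of
such data is NOT shown here. [cite: Hu2022, p.132 l.30–51 ((9.4) `Gr_d|_O ≅ O × (𝔾ⁿ_m/𝔾_m)`, split `𝔾^{n−1}_m`) with p.134 l.38–40; joint J1 = GAP-LEDGER-HU row HU-R01 (unrefereed preprints arXiv:2203.03842v4 / arXiv:2507.21400v1 under adjudication, D-0012/D-0089 — API of OUR row-110 records g/h `splitTorusOver` / `quot_trivialises`; nothing of the sources asserted)] -/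
def Hu22Setup_ours.toPrintedOurs (S : Hu22Setup_ours 𝔽 n M) (L : LafforgueObjects) (hr : 0 < S.r)
    (hfree : TorusFreeOnCell M) (isoBarGr : (S.U : Scheme.{0}) ≅ L.barGr n M hfree)
    (htriv : SplitTorusOver.Trivialises (n - 1) S.quot) : Hu22Setup_printed_ours L 𝔽 n M where
  toHu22Setup_ours := S
  r_pos := hr
  hfree := hfree
  isoBarGr := isoBarGr
  quot_trivialises := htriv

/-- **Packaging (file g)**: the same plus the literal clause `IsAffineFiniteTypeOverInt X` gives an `Hu22Setup_printed L 𝔽 n d`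
datum (empty at `𝔽 = ℚ` by `PrintedSettingRatEmpty`; meaningful at `𝔽 = 𝔽_p`). OURS bookkeeping; existence not shown here.
[cite: Hu2022, p.132 l.30–51 ((9.4) `Gr_d|_O ≅ O × (𝔾ⁿ_m/𝔾_m)`, split `𝔾^{n−1}_m`) with p.134 l.38–40; joint J1 = GAP-LEDGER-HU row HU-R01 (unrefereed preprints arXiv:2203.03842v4 / arXiv:2507.21400v1 under adjudication, D-0012/D-0089 — API of OUR row-110 records g/h `splitTorusOver` / `quot_trivialises`; nothing of the sources asserted)] -/
def Hu22Setup_ours.toPrinted (S : Hu22Setup_ours 𝔽 n M) (L : LafforgueObjects) (hX : IsAffineFiniteTypeOverInt S.X)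
    (hr : 0 < S.r) (hfree : TorusFreeOnCell M) (isoBarGr : (S.U : Scheme.{0}) ≅ L.barGr n M hfree)
    (htriv : SplitTorusOver.Trivialises (n - 1) S.quot) : Hu22Setup_printed L 𝔽 n M where
  toHu22Setup_ours := S
  X_thm94 := hX
  r_pos := hr
  hfree := hfree
  isoBarGr := isoBarGr
  quot_trivialises := htriv

end Bridges

end Literature.AlgebraicGeometry.Hu2025.Statements.S01S09Interface

end
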